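import Mathlib
import Summits.Schanuel.Schanuel.Statement
import Literature.NumberTheory.Transcendental.RoyCriterion
import Summits.Schanuel.Schanuel.Theorems.SoloBlindRoyWindow
import Summits.Schanuel.Schanuel.Theorems.SoloBlindProfileNoGo
import HarnessLib

/-!
# Roy's window lies inside the rank-two profile no-go region (solo-Schanuel-blind, session 5)

Notation as in `SoloBlindProfileNoGo.lean`: `δ := max{t₀, s₁+t₁}` is the degree exponent and `σ`
(any `s₀ ≤ σ < u`) the log-height exponent of the orbit family
`{(D^k P_N)∘[m] : k ≤ N^{s₀}, ‖m‖ ≤ N^{s₁}}` produced by the hypothesis of Roy's Conjecture 2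
(⟺ Schanuel, rank by rank) at a point `θ ∈ ℂ^{2l}`; its values at `θ` are `≤ exp(-N^u)`.

**Proposition NG″** (`run/shared/lean/ideation/Schanuel/solo-blind/paper/nogo.md` §6, proved there;
exact-arithmetic bookkeeping for every `N ≤ 10^6` and a sample up to `10^30` in `work/nogo2_check.py`).
Call a *profile criterion of strength* `(l; δ, σ, u)` the assertion: for every `m ≥ l` and `θ ∈ ℂ^m`, if
for all large `N` there is a finite family of non-zero `Q ∈ ℤ[X₁,…,X_m]`, `deg Q ≤ N^δ`,
`log H(Q) ≤ N^σ`, without common zero in `ℂ^m` and with `|Q(θ)| ≤ exp(-N^u)`, then `trdeg_ℚ ℚ(θ) ≥ l`.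
(Philippon 1986 Thm 2.11, Jabbouri 1992, Laurent–Roy 2001 without multiplicities and Philippon's
"approximations algébriques" criteria are of this form, with `u` above a threshold `≍ max{σ,δ} + (l-1)δ`.)
If
`4 (u - σ) < σ`, `σ < 2 δ` and `2 (u - δ) < σ`,
then EVERY profile criterion of strength `(l; δ, σ, u)` with `l ≥ 2` is false. Witness: ONE real number
`x = 1 + Σ_k 2^{-a_k}`, `a_{k+1} = a_k²`, the point `θ = (x, 1, …, 1)` (transcendence degree `≤ 1`),
and at scale `N` the two coprime powers `(q_k X₁ - p_k)^j`, `(q_{k-1} X₁ - p_{k-1})^{j'}` of consecutive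
approximants (`q_k = 2^{a_k}`), which serve every `N ≥ N₀`. This supersedes Proposition NG of session 3
(which needed `l ≥ 3`, two interleaved Liouville coordinates and the coprime companion of
`SoloBlindCoprimeCompanion.lean`) and closes its open case `l = 2` (the rank of `e` and `π`).

This file is the kernel half: the three hypotheses hold at EVERY admissible quintuple of Roy's window
and every `σ ∈ [s₀, u)` (`royAdmissible_profile_nogo₂`), with the explicit margins
`4 (u - σ) < 1 < σ`, `σ < u < 2 (s₁ + t₁) ≤ 2δ`, `2 (u - δ) < 1 - t₁ < 1 < σ`
(`royAdmissible_profile_margins₂`). Consequence for the wall statement (§3 (A′), §4 R-A3): at every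
admissible parameter and every rank `l ≥ 2` — including the deciding small ranks — no criterion reading
only the profile of the orbit family (count, degrees, heights, sizes, common-zero-freeness) can complete
Roy's programme; the algebraic relations inside the orbit family (closure under `D` and `[m]`) must be
consumed by the concluding step.

[cite: Roy2001, condition (1) and Conjecture 2; Waldschmidt 2022, LNM 2313, Conjecture 8.1;
Nesterenko–Philippon (eds.), LNM 1752 (2001), Ch. 8 §8.1 (Philippon's criterion) and Ch. 15 §3]
-/

namespace Summit.Schanuel.Schanuel.Theorems

open Literature.NumberTheory.Transcendental

variable {s₀ s₁ t₀ t₁ u : ℝ}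

/-- Explicit margins behind the rank-two placement: in Roy's window
`4(u - s₀) < 1`, `u < 2(s₁ + t₁)` and `2(u - (s₁ + t₁)) < 1 - t₁`. -/
theorem royAdmissible_profile_margins₂ (h : RoyAdmissible s₀ s₁ t₀ t₁ u) :
    4 * (u - s₀) < 1 ∧ u < 2 * (s₁ + t₁) ∧ 2 * (u - (s₁ + t₁)) < 1 - t₁ := by
  obtain ⟨h0, h1, h2, h3, h4, g1, g2, g3, g4, g5, g6, k1, k2, k3⟩ := royAdmissible_unpack h
  refine ⟨?_, ?_, ?_⟩ <;> linarith

/-- **Placement of the window in the rank-two profile no-go region.** For every admissible quintuple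
and every height exponent `σ` with `s₀ ≤ σ < u`, writing `δ = max{t₀, s₁+t₁}`:
`4(u - σ) < σ`, `σ < 2δ` and `2(u - δ) < σ` — the hypotheses of Proposition NG″ of `paper/nogo.md` §6. -/
theorem royAdmissible_profile_nogo₂ (h : RoyAdmissible s₀ s₁ t₀ t₁ u) {σ : ℝ}
    (hσ : s₀ ≤ σ) (hσu : σ < u) :
    4 * (u - σ) < σ ∧ σ < 2 * max t₀ (s₁ + t₁) ∧ 2 * (u - max t₀ (s₁ + t₁)) < σ := by
  obtain ⟨m1, m2, m3⟩ := royAdmissible_profile_margins₂ h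
  obtain ⟨h0, h1, h2, h3, h4, g1, g2, g3, g4, g5, g6, k1, k2, k3⟩ := royAdmissible_unpack h
  have hδ : s₁ + t₁ ≤ max t₀ (s₁ + t₁) := le_max_right _ _
  refine ⟨by linarith, by linarith, by linarith⟩

/-- The same placement with the sharper numerical margins made explicit:
`4(u - σ) < 1 < σ` and `2(u - δ) < 1 < σ`. -/
theorem royAdmissible_profile_nogo₂' (h : RoyAdmissible s₀ s₁ t₀ t₁ u) {σ : ℝ}
    (hσ : s₀ ≤ σ) (hσu : σ < u) :
    4 * (u - σ) < 1 ∧ 1 < σ ∧ 2 * (u - max t₀ (s₁ + t₁)) < 1 := by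
  obtain ⟨m1, m2, m3⟩ := royAdmissible_profile_margins₂ h
  obtain ⟨h0, h1, h2, h3, h4, g1, g2, g3, g4, g5, g6, k1, k2, k3⟩ := royAdmissible_unpack h
  have hδ : s₁ + t₁ ≤ max t₀ (s₁ + t₁) := le_max_right _ _
  refine ⟨by linarith, by linarith, by linarith⟩

/-- Both no-go regions at once: the session-3 region (`δ < u`, `σ < u`, `max{u,σ,δ}(u-δ) < σ²`,
Proposition NG, ranks `≥ 3`) and the session-5 region (Proposition NG″, ranks `≥ 2`) contain the
whole window. -/
theorem royAdmissible_profile_nogo_all (h : RoyAdmissible s₀ s₁ t₀ t₁ u) {σ : ℝ}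
    (hσ : s₀ ≤ σ) (hσu : σ < u) :
    (max t₀ (s₁ + t₁) < u ∧ σ < u ∧
      max u (max σ (max t₀ (s₁ + t₁))) * (u - max t₀ (s₁ + t₁)) < σ ^ 2) ∧
    (4 * (u - σ) < σ ∧ σ < 2 * max t₀ (s₁ + t₁) ∧ 2 * (u - max t₀ (s₁ + t₁)) < σ) :=
  ⟨royAdmissible_profile_nogo h hσ hσu, royAdmissible_profile_nogo₂ h hσ hσu⟩

/-- Sanity instance at the admissible point `(t₀,t₁,s₀,s₁,u) = (1.03, 0.52, 1.06, 0.53, 1.10)` with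
`σ = s₀ = 1.06`, `δ = max{1.03, 1.05} = 1.05`: `4·0.04 = 0.16 < 1.06`, `1.06 < 2.1`, `2·0.05 = 0.1 < 1.06`. -/
example : 4 * ((1.10 : ℝ) - 1.06) < 1.06 ∧ (1.06 : ℝ) < 2 * max 1.03 (0.53 + 0.52) ∧
    2 * ((1.10 : ℝ) - max 1.03 (0.53 + 0.52)) < 1.06 := by
  refine ⟨by norm_num, ?_, ?_⟩
  · have : (0.53 : ℝ) + 0.52 ≤ max 1.03 (0.53 + 0.52) := le_max_right _ _
    linarith
  · have : (0.53 : ℝ) + 0.52 ≤ max 1.03 (0.53 + 0.52) := le_max_right _ _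
    linarith

#harness_tags royAdmissible_profile_nogo₂

end Summit.Schanuel.Schanuel.Theorems
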